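import Literature.Geometry.Kaehler.RiemannSurfaceUnramifiedCoveringFunctionField
import Literature.Geometry.Kaehler.RiemannSurfaceAbelianCovers
import HarnessLib

/-!
# Unramified abelian extensions of the function field of a compact Riemann surface: Galois groups = finite quotients of `H₁(N, ℤ) ≅ ℤ^{2g}`

Topic `Literature/Geometry/Kaehler` — sequel of `RiemannSurfaceUnramifiedCoveringFunctionField` (for an unramified
holomorphic covering `q : Y → N` of compact connected Riemann surfaces: `q_* π₁(Y) ⊴ π₁(N)` iff `𝒦(Y)/q^*𝒦(N)` is
Galois, and then `Gal ≅ π₁(N, x₀) ⧸ q_* π₁(Y, e₀)`; every finite quotient of `π₁` is such a Galois group) and of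
`RiemannSurfaceAbelianCovers` ∕ `RiemannSurfaceFirstHomologyPeriods` (`π₁(N, x₀)ᵃᵇ ≅ ℤ^{2g}`, Hatcher §1.3
Ex. 17–19 on abelian covers).  The classical dictionary «unramified abelian coverings ∕ extensions ↔ quotients of
`H₁(N, ℤ) = π₁ᵃᵇ`» (Forster §8.12 with Hatcher 1.39 and Cor. 1.27 ∕ 2A.1), assembled; no class field theory is
claimed beyond what is printed there.

Setting: `q : Y → N` an unramified holomorphic covering of compact connected Riemann surfaces, `e₀ ∈ q⁻¹(x₀)`,
`H = q_* π₁(Y, e₀)`, `K = q^*𝒦(N)`, `Gal = 𝒦(Y) ≃ₐ[K] 𝒦(Y)`; `g = g(N)`.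

## What is proved (everything; no definitions, no instances, no named facts)

* §1 **`isGalois_and_comm_iff_commutator_le`** — `𝒦(Y)/K` is Galois with COMMUTATIVE Galois group iff
  `[π₁(N, x₀), π₁(N, x₀)] ≤ H` (iff `H ⊴ π₁` with abelian quotient): unramified abelian extensions correspond to the
  subgroups of finite index of `π₁` containing the commutator subgroup, i.e. to the subgroups of finite index of
  `H₁(N, ℤ) = π₁ᵃᵇ`;
* §2 **`exists_surjective_pi_int_gal_of_comm`** — the Galois group of an unramified abelian extension is a quotient of
  `ℤ^{2g} ≅ π₁(N, x₀)ᵃᵇ`: there is a surjection `ℤ^{2g} ↠ Gal` (additively written);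
* §3 **`exists_isGalois_mulEquiv_of_addMonoidHom_surjective`** — conversely every finite abelian group `A` that is a
  quotient of `ℤ^{2g}` is the Galois group of an unramified abelian extension `𝒦(T)/p^*𝒦(N)` coming from an unramified
  holomorphic covering `p : T → N` by a compact connected Riemann surface;
* §4 **`exists_unramified_gal_mulEquiv_iff`** — summary: a finite abelian group is the Galois group of the function
  field extension of an unramified holomorphic Galois covering of `N` iff it is a quotient of `ℤ^{2g}`.

## References
* O. Forster, *Lectures on Riemann Surfaces*, GTM 81, Springer 1981, §8.12 Theorem, §8.3. [Forster1981]
* A. Hatcher, *Algebraic Topology*, CUP 2002, §1.3 Prop. 1.39 (p. 71), Exercises 17–19 (p. 82), Cor. 1.27,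
  §2.A Thm. 2A.1. [HatcherAT2002]
* H. M. Farkas, I. Kra, *Riemann Surfaces*, 2nd ed., GTM 71, Springer 1992, I.2.5. [FarkasKra1992]
-/

noncomputable section

open scoped Manifold ContDiff Topology IntermediateField
open Set Function MulAction Module

namespace Literature.Geometry.Kaehler

open Literature.Topology.CoveringSpaces

namespace RiemannSurface

open FunctionField

universe u v

/-! ### §0 Group-theoretic bookkeeping: abelian quotients and the commutator subgroup -/

/-- `G ⧸ K` is commutative iff `[G, G] ≤ K` (for `K ⊴ G`). [cite: HatcherAT2002, §2.A Thm. 2A.1 (abelianization)] -/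
private theorem forall_quotient_comm_iff_commutator_le {G : Type*} [Group G] (K : Subgroup G) [K.Normal] :
    (∀ a b : G ⧸ K, a * b = b * a) ↔ commutator G ≤ K := by
  rw [commutator_def, Subgroup.commutator_le]
  constructor
  · intro h a _ b _
    have hab := h (QuotientGroup.mk b) (QuotientGroup.mk a)
    rw [← QuotientGroup.mk_mul, ← QuotientGroup.mk_mul, QuotientGroup.eq] at hab
    -- `(b a)⁻¹ (a b) = a⁻¹ b⁻¹ a b ∈ K`, and `⁅a, b⁆ = a b a⁻¹ b⁻¹` is its conjugate by `a b`… use normality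
    have h1 : (a * b) * ((b * a)⁻¹ * (a * b)) * (a * b)⁻¹ ∈ K := ‹K.Normal›.conj_mem _ hab (a * b)
    rw [commutatorElement_def]
    convert h1 using 1
    group
  · intro h a b
    induction a using QuotientGroup.induction_on with
    | H a =>
    induction b using QuotientGroup.induction_on with
    | H b =>
    rw [← QuotientGroup.mk_mul, ← QuotientGroup.mk_mul, QuotientGroup.eq]
    -- `(a b)⁻¹ (b a) = b⁻¹ a⁻¹ b a = ⁅b⁻¹, a⁻¹⁆`
    have h1 := h b⁻¹ (Subgroup.mem_top _) a⁻¹ (Subgroup.mem_top _)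
    rw [commutatorElement_def, inv_inv, inv_inv] at h1
    convert h1 using 1
    group

/-- A subgroup containing the commutator subgroup is normal (`g h g⁻¹ = ⁅g, h⁆ h`).
[cite: HatcherAT2002, §2.A Thm. 2A.1 (abelianization)] -/
private theorem normal_of_commutator_le {G : Type*} [Group G] {K : Subgroup G} (h : commutator G ≤ K) :
    K.Normal := by
  refine ⟨fun k hk g ↦ ?_⟩
  have h1 := h (Subgroup.commutator_mem_commutator (Subgroup.mem_top g) (Subgroup.mem_top k))
  rw [commutatorElement_def] at h1
  have h2 : g * k * g⁻¹ = g * k * g⁻¹ * k⁻¹ * k := by group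
  rw [h2]
  exact K.mul_mem h1 hk

/-- Commutativity is transported along a group isomorphism. [cite: HatcherAT2002, §1.3 Prop. 1.39] -/
private theorem forall_comm_of_mulEquiv {A B : Type*} [Mul A] [Mul B] (e : A ≃* B)
    (h : ∀ a b : A, a * b = b * a) (x y : B) : x * y = y * x := by
  obtain ⟨a, rfl⟩ := e.surjective x
  obtain ⟨b, rfl⟩ := e.surjective y
  rw [← map_mul, h, map_mul]

/-- For `[G, G] ≤ K ⊴ G`, the projection `G → G ⧸ K` factors through a SURJECTIVE homomorphism
`Gᵃᵇ = G ⧸ [G, G] → G ⧸ K`. [cite: HatcherAT2002, §2.A Thm. 2A.1 (abelianization)] -/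
private theorem exists_surjective_abelianization_of_commutator_le {G : Type*} [Group G] (K : Subgroup G)
    [K.Normal] (h : commutator G ≤ K) :
    ∃ L : Abelianization G →* G ⧸ K, Surjective L ∧ ∀ g : G, L (Abelianization.of g) = QuotientGroup.mk g := by
  have hker : commutator G ≤ (QuotientGroup.mk' K).ker := by rwa [QuotientGroup.ker_mk']
  refine ⟨QuotientGroup.lift (commutator G) (QuotientGroup.mk' K) hker, fun x ↦ ?_, fun g ↦ rfl⟩
  induction x using QuotientGroup.induction_on with
  | H g => exact ⟨Abelianization.of g, rfl⟩

variable {N : Type u} [TopologicalSpace N] [ChartedSpace ℂ N] [ConnectedSpace N] [IsManifold 𝓘(ℂ, ℂ) ω N]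
  [CompactSpace N] [T2Space N]
  {Y : Type v} [TopologicalSpace Y] [ChartedSpace ℂ Y] [ConnectedSpace Y] [IsManifold 𝓘(ℂ, ℂ) ω Y]
  [CompactSpace Y] [T2Space Y]
  {q : Y → N} (hq : MDifferentiable 𝓘(ℂ, ℂ) 𝓘(ℂ, ℂ) q) (hne : ∃ a b, q a ≠ q b) (hc : IsCoveringMap q)

/-! ### §1 Unramified abelian extensions ↔ subgroups containing the commutator subgroup -/

/-- **`𝒦(Y)/q^*𝒦(N)` is an ABELIAN Galois extension iff `[π₁(N, x₀), π₁(N, x₀)] ≤ q_* π₁(Y, e₀)`** (iff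
`H = q_* π₁(Y, e₀)` is normal with abelian quotient `π₁ ⧸ H ≅ Gal`): the unramified abelian extensions of the
function field of `N` by function fields of compact Riemann surfaces correspond to the finite-index subgroups of
`π₁(N, x₀)` containing the commutator subgroup, i.e. of `H₁(N, ℤ) = π₁ᵃᵇ` (Forster 8.12 + Hatcher 1.39, 2A.1).
[cite: Forster1981, §8.12 Theorem] [cite: HatcherAT2002, §1.3 Prop. 1.39 (p. 71), §2.A Thm. 2A.1] -/
theorem isGalois_and_comm_iff_commutator_le {x₀ : N} (e₀ : q ⁻¹' {x₀}) :
    (IsGalois ↥(comap q hq hne).fieldRange (FunctionField Y) ∧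
        ∀ σ τ : (FunctionField Y ≃ₐ[↥(comap q hq hne).fieldRange] FunctionField Y), σ * τ = τ * σ) ↔
      commutator (FundamentalGroup N x₀) ≤ (FundamentalGroup.mapOfEq ⟨q, hc.continuous⟩ e₀.2).range := by
  constructor
  · rintro ⟨hG, hcomm⟩
    have hN := (normal_range_mapOfEq_iff_isGalois hq hne hc e₀).2 hG
    haveI := hN
    obtain ⟨e⟩ := nonempty_algEquiv_mulEquiv_quotient_of_normal hq hne hc e₀ hN
    exact (forall_quotient_comm_iff_commutator_le _).1 (forall_comm_of_mulEquiv e hcomm)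
  · intro h
    haveI hN : (FundamentalGroup.mapOfEq ⟨q, hc.continuous⟩ e₀.2).range.Normal := normal_of_commutator_le h
    obtain ⟨e⟩ := nonempty_algEquiv_mulEquiv_quotient_of_normal hq hne hc e₀ hN
    exact ⟨(normal_range_mapOfEq_iff_isGalois hq hne hc e₀).1 hN,
      forall_comm_of_mulEquiv e.symm ((forall_quotient_comm_iff_commutator_le _).2 h)⟩

/-- The normal, abelian-quotient form: `𝒦(Y)/q^*𝒦(N)` is abelian Galois iff `H ⊴ π₁(N, x₀)` and `π₁ ⧸ H` is
commutative. [cite: Forster1981, §8.12 Theorem] [cite: HatcherAT2002, §1.3 Prop. 1.39 (p. 71)] -/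
theorem isGalois_and_comm_iff_normal_and_comm {x₀ : N} (e₀ : q ⁻¹' {x₀}) :
    (IsGalois ↥(comap q hq hne).fieldRange (FunctionField Y) ∧
        ∀ σ τ : (FunctionField Y ≃ₐ[↥(comap q hq hne).fieldRange] FunctionField Y), σ * τ = τ * σ) ↔
      ∃ _ : (FundamentalGroup.mapOfEq ⟨q, hc.continuous⟩ e₀.2).range.Normal,
        ∀ a b : FundamentalGroup N x₀ ⧸ (FundamentalGroup.mapOfEq ⟨q, hc.continuous⟩ e₀.2).range,
          a * b = b * a := by
  rw [isGalois_and_comm_iff_commutator_le hq hne hc e₀]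
  constructor
  · intro h
    haveI := normal_of_commutator_le h
    exact ⟨‹_›, (forall_quotient_comm_iff_commutator_le _).2 h⟩
  · rintro ⟨hN, hcomm⟩
    exact (forall_quotient_comm_iff_commutator_le _).1 hcomm

/-! ### §2 The Galois group of an unramified abelian extension is a quotient of `ℤ^{2g}` -/

include hc in
/-- **The Galois group of an unramified abelian extension of `𝒦(N)` is a quotient of `H₁(N, ℤ) ≅ ℤ^{2g}`**: if
`𝒦(Y)/q^*𝒦(N)` is Galois with commutative group, there is a surjection `ℤ^{2g} ↠ Gal` (`g = g(N)`; additively: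
onto `Additive Gal`) — `Gal ≅ π₁ ⧸ H` with `[π₁, π₁] ≤ H`, through `π₁ᵃᵇ ≅ ℤ^{2g}`.
[cite: Forster1981, §8.12 Theorem] [cite: HatcherAT2002, §1.3 Prop. 1.39, Cor. 1.27, §2.A Thm. 2A.1]
[cite: FarkasKra1992, I.2.5] -/
theorem exists_surjective_pi_int_gal_of_comm {x₀ : N} (e₀ : q ⁻¹' {x₀})
    (hG : IsGalois ↥(comap q hq hne).fieldRange (FunctionField Y))
    (hcomm : ∀ σ τ : (FunctionField Y ≃ₐ[↥(comap q hq hne).fieldRange] FunctionField Y), σ * τ = τ * σ) :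
    ∃ ψ : (Fin (2 * arithGenus N) → ℤ) →+
        Additive (FunctionField Y ≃ₐ[↥(comap q hq hne).fieldRange] FunctionField Y), Surjective ψ := by
  set H := (FundamentalGroup.mapOfEq ⟨q, hc.continuous⟩ e₀.2).range with hH
  have hle : commutator (FundamentalGroup N x₀) ≤ H := (isGalois_and_comm_iff_commutator_le hq hne hc e₀).1 ⟨hG, hcomm⟩
  haveI : H.Normal := normal_of_commutator_le hle
  obtain ⟨e⟩ := nonempty_algEquiv_mulEquiv_quotient_of_normal hq hne hc e₀ ‹_›
  obtain ⟨L, hL, -⟩ := exists_surjective_abelianization_of_commutator_le H hle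
  obtain ⟨f⟩ := nonempty_abelianization_addEquiv_pi x₀
  -- `ℤ^{2g} ≅ π₁ᵃᵇ ↠ π₁ ⧸ H ≅ Gal`
  refine ⟨((MonoidHom.toAdditive (e.symm.toMonoidHom.comp L))).comp f.symm.toAddMonoidHom, ?_⟩
  exact ((e.symm.surjective.comp hL)).comp f.symm.surjective

include hc in
/-- Numerical corollary: the Galois group of an unramified abelian extension is generated by the images of the `2g`
standard basis vectors, so it is a finite abelian group on at most `2g` generators; in particular for `g = 0` it is
trivial. [cite: HatcherAT2002, §1.3 Exercises 17–19 (p. 82), Cor. 1.27] [cite: Forster1981, §8.12 Theorem] -/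
theorem subsingleton_gal_of_comm_of_arithGenus_eq_zero {x₀ : N} (e₀ : q ⁻¹' {x₀}) (h0 : arithGenus N = 0)
    (hG : IsGalois ↥(comap q hq hne).fieldRange (FunctionField Y))
    (hcomm : ∀ σ τ : (FunctionField Y ≃ₐ[↥(comap q hq hne).fieldRange] FunctionField Y), σ * τ = τ * σ) :
    Subsingleton (FunctionField Y ≃ₐ[↥(comap q hq hne).fieldRange] FunctionField Y) := by
  obtain ⟨ψ, hψ⟩ := exists_surjective_pi_int_gal_of_comm hq hne hc e₀ hG hcomm
  haveI : Subsingleton (Fin (2 * arithGenus N) → ℤ) := by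
    rw [h0, mul_zero]
    infer_instance
  haveI : Subsingleton (Additive (FunctionField Y ≃ₐ[↥(comap q hq hne).fieldRange] FunctionField Y)) :=
    hψ.subsingleton
  exact Additive.ofMul.injective.subsingleton

/-! ### §3 Every finite quotient of `ℤ^{2g}` is an unramified abelian Galois group over `𝒦(N)` -/

omit hq hne hc in
/-- **Every finite abelian group `A` admitting a surjection `ℤ^{2g} ↠ A` is the Galois group of an unramified abelian
extension of `𝒦(N)`**: there are a compact connected Riemann surface `T`, an unramified holomorphic covering
`p : T → N`, and `𝒦(T)/p^*𝒦(N)` is Galois with group `≅ Multiplicative A` (through `π₁ ↠ π₁ᵃᵇ ≅ ℤ^{2g} ↠ A` and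
`exists_isGalois_functionField_of_surjective`). [cite: Forster1981, §8.12 Theorem]
[cite: HatcherAT2002, §1.3 Exercises 17, 19 (p. 82), Prop. 1.39] -/
theorem exists_isGalois_mulEquiv_of_addMonoidHom_surjective (x₀ : N) {A : Type*} [AddCommGroup A] [Finite A]
    (ψ : (Fin (2 * arithGenus N) → ℤ) →+ A) (hψ : Surjective ψ) :
    ∃ (T : Type u) (_ : TopologicalSpace T) (_ : ChartedSpace ℂ T) (_ : IsManifold 𝓘(ℂ, ℂ) ω T)
      (_ : CompactSpace T) (_ : T2Space T) (_ : ConnectedSpace T) (p : T → N)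
      (hp : MDifferentiable 𝓘(ℂ, ℂ) 𝓘(ℂ, ℂ) p) (hpne : ∃ a b, p a ≠ p b),
      IsCoveringMap p ∧ IsGalois ↥(comap p hp hpne).fieldRange (FunctionField T) ∧
        finrank ↥(comap p hp hpne).fieldRange (FunctionField T) = Nat.card A ∧
        Nonempty ((FunctionField T ≃ₐ[↥(comap p hp hpne).fieldRange] FunctionField T) ≃* Multiplicative A) := by
  obtain ⟨f⟩ := nonempty_abelianization_addEquiv_pi x₀
  -- `φ : π₁ ↠ π₁ᵃᵇ ≅ ℤ^{2g} ↠ A`, multiplicatively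
  let ψ' : Additive (Abelianization (FundamentalGroup N x₀)) →+ A := ψ.comp f.toAddMonoidHom
  have hψ' : Surjective ψ' := hψ.comp f.surjective
  let φ : FundamentalGroup N x₀ →* Multiplicative A := (AddMonoidHom.toMultiplicativeRight ψ').comp Abelianization.of
  have hof : Surjective (Abelianization.of : FundamentalGroup N x₀ →* _) := fun a ↦ by
    obtain ⟨g, hg⟩ := QuotientGroup.mk_surjective a
    exact ⟨g, hg⟩
  have hφ : Surjective φ := by
    have h1 : Surjective (AddMonoidHom.toMultiplicativeRight ψ') := by
      rw [AddMonoidHom.coe_toMultiplicativeRight]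
      exact Multiplicative.ofAdd.surjective.comp (hψ'.comp Additive.ofMul.surjective)
    exact h1.comp hof
  have hcard : Nat.card (Multiplicative A) = Nat.card A := Nat.card_congr Multiplicative.toAdd
  obtain ⟨T, i1, i2, i3, i4, i5, i6, p, hp, hpne, hpc, hG, hdeg, hiso⟩ :=
    exists_isGalois_functionField_of_surjective x₀ φ hφ
  exact ⟨T, i1, i2, i3, i4, i5, i6, p, hp, hpne, hpc, hG, hdeg.trans hcard, hiso⟩

/-! ### §4 Summary: the unramified abelian Galois groups over `𝒦(N)` are exactly the finite quotients of `ℤ^{2g}` -/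

omit hq hne hc in
/-- **The finite abelian groups occurring as Galois groups of function field extensions of unramified holomorphic
Galois coverings `T → N` of the compact Riemann surface `N` are exactly the quotients of `H₁(N, ℤ) ≅ ℤ^{2g}`.**
(⇐ §3; ⇒ §2: such a Galois group, being abelian, receives a surjection from `ℤ^{2g}`.)
[cite: Forster1981, §8.12 Theorem] [cite: HatcherAT2002, §1.3 Exercises 17–19 (p. 82), Prop. 1.39, Cor. 1.27] -/
theorem exists_unramified_gal_mulEquiv_iff (x₀ : N) {A : Type*} [AddCommGroup A] [Finite A] :
    (∃ (T : Type u) (_ : TopologicalSpace T) (_ : ChartedSpace ℂ T) (_ : IsManifold 𝓘(ℂ, ℂ) ω T)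
      (_ : CompactSpace T) (_ : T2Space T) (_ : ConnectedSpace T) (p : T → N)
      (hp : MDifferentiable 𝓘(ℂ, ℂ) 𝓘(ℂ, ℂ) p) (hpne : ∃ a b, p a ≠ p b),
      IsCoveringMap p ∧ IsGalois ↥(comap p hp hpne).fieldRange (FunctionField T) ∧
        Nonempty ((FunctionField T ≃ₐ[↥(comap p hp hpne).fieldRange] FunctionField T) ≃* Multiplicative A)) ↔
      ∃ ψ : (Fin (2 * arithGenus N) → ℤ) →+ A, Surjective ψ := by
  constructor
  · rintro ⟨T, _, _, _, _, _, _, p, hp, hpne, hpc, hG, ⟨e⟩⟩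
    obtain ⟨t⟩ : Nonempty T := inferInstance
    have hcomm : ∀ σ τ : (FunctionField T ≃ₐ[↥(comap p hp hpne).fieldRange] FunctionField T), σ * τ = τ * σ :=
      forall_comm_of_mulEquiv e.symm fun a b ↦ mul_comm a b
    obtain ⟨ψ, hψ⟩ := exists_surjective_pi_int_gal_of_comm hp hpne hpc (⟨t, rfl⟩ : p ⁻¹' {p t}) hG hcomm
    -- `ℤ^{2g} ↠ Additive Gal ≅ Additive (Multiplicative A) = A`
    refine ⟨((MulEquiv.toAdditive e).toAddMonoidHom.comp ψ : (Fin (2 * arithGenus N) → ℤ) →+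
      Additive (Multiplicative A)), ?_⟩
    exact (MulEquiv.toAdditive e).surjective.comp hψ
  · rintro ⟨ψ, hψ⟩
    obtain ⟨T, i1, i2, i3, i4, i5, i6, p, hp, hpne, hpc, hG, -, hiso⟩ :=
      exists_isGalois_mulEquiv_of_addMonoidHom_surjective x₀ ψ hψ
    exact ⟨T, i1, i2, i3, i4, i5, i6, p, hp, hpne, hpc, hG, hiso⟩

end RiemannSurface

end Literature.Geometry.Kaehler

end
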